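import Mathlib.Analysis.SpecificLimits.Basic
import Mathlib.Analysis.Normed.Group.InfiniteSum
import Literature.NumberTheory.Sieve.AsymptoticSieveForPrimesInputs
import Literature.NumberTheory.Sieve.SieveFrameworkProofs
import HarnessLib

/-!
# Asymptotic sieve for primes: the complete inner sums of §4 (log-weighted Möbius–density sums)

Trunk T-SIEVE. Source: J. Friedlander, H. Iwaniec, *Asymptotic sieve for primes*, Ann. of Math. 148
(1998) 1041–1065 [FriedlanderIwaniecASP1998] (= arXiv:math/9811186), §4 "Evaluation of
`T(x; Y)`", pp. 1053–1054: "We extend the summation to all `b` making an error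
`≪ A(x)(log x)^{-3}`, by (2.4). Then, we evaluate the complete inner sum as
`∑_{η ∣ ν} μ(η) ∑_{(b,ν)=1} μ(b)g(b) log ηb = ∑_{η ∣ ν} μ(η) ∑_{(b,ν)=1} μ(b)g(b) log b`
and this is equal to `-H` if `ν = 1` and equal to zero otherwise."

This file proves that evaluation, with a rate, from the CONCLUSIONS of the two deep inputs of the
tree taken as hypotheses — the Möbius–density cancellation (2.4)
(`fi_moebius_density_cancellation`, `…Inputs`: `|∑_{d ≤ y, (d,ν)=1} μ(d)g(d)| ≤ K σ_ν (log y)^{-6}`)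
and the logarithmic sum (1.14) (`fi_moebius_density_log_sum`: `∑_{b ≤ N} μ(b)g(b) log b → -H`):

* `tendsto_sum_mul_log_of_abs_sum_le` — Abel summation (`sum_Icc_mul_log_eq`): a bound
  `|∑_{b ≤ N} f(b)| ≤ K (log(N+1))^{-6}` gives the convergence of `∑_{b ≤ N} f(b) log b` with the
  rate `2K (log N)^{-5}` (telescoping majorant `(log b)^{-5} - (log(b+1))^{-5}`,
  `sub_div_pow_six_le`);
* `sum_coprime_moebius_mul_log_eq` — the exact divisor recursion
  `R_ν(N) = ∑_{η ∣ ν} g(η) (log η S_η(N/η) + R_η(N/η))` for the coprime-restricted sums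
  `S_ν(N) = ∑_{c ≤ N, (c,ν)=1} μ(c)g(c)`, `R_ν(N) = ∑_{c ≤ N, (c,ν)=1} μ(c)g(c) log c`
  (`[(b,ν)=1] = ∑_{η ∣ (b,ν)} μ(η)`, `b = ηc`);
* `limit_of_divisor_recursion`, `limit_values` — in the limit `r_ν = ∑_{η ∣ ν} g(η) r_η`, whence
  `r_ν = -H / V(ν)`, `V(ν) = ∏_{p ∣ ν} (1 - g(p))`, from `r_1 = -H`
  (`∑_{η ∣ ν} g(η)/V(η) = 1/V(ν)`, `sum_divisors_density_div_prod_eq`);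
* `sum_squarefree_moebius_density_div_gcd_mul_log_eq` — FI's rearrangement
  `∑_{b ≤ M sqfree} μ(b) g(b/(b,ν)) log b = ∑_{η ∣ ν} μ(η)(log η S_ν(M/η) + R_ν(M/η))`
  (the bijection `b ↦ ((b,ν), b/(b,ν))`, as in `abs_sum_moebius_density_div_gcd_le` of `…Tyz`);
* `tendsto_sum_coprime_moebius_mul_log` — `R_ν(N) → -H/V(ν)` with
  `|R_ν(N) + H/V(ν)| ≤ 2(64Kσ_ν + 1)(log N)^{-5}` (`N ≥ 2`);
* `abs_complete_inner_log_sum_sub_le` — for squarefree `ν` and `M ≥ 2ν`,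
  `|∑_{b ≤ M sqfree} μ(b) g(b/(b,ν)) log b + H[ν = 1]|
    ≤ τ(ν)(64Kσ_ν + 1)(log ν (log(M/ν+1))^{-6} + 2(log(M/ν))^{-5})`.

This is the main-term input for the evaluation (4.4)–(4.5) of `T(x; Y)` (`fi_asp_T_estimate`).

## Faithfulness notes

FI pass to the limit via (2.4) and quote (1.13)–(1.14) for the value; the only point not printed
is the identification of the limits `r_ν` for `ν > 1`, done here by the divisor recursion (the
series are not absolutely convergent, so everything is phrased with partial sums and `Tendsto`).

## Mathlib search

Used: `Finset.sum_range_sub'`, `hasSum_iff_tendsto_nat_of_nonneg`, `Summable.of_nonneg_of_le`,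
`summable_nat_add_iff`, `Summable.sum_add_tsum_nat_add`, `norm_tsum_le_tsum_norm`,
`Summable.tsum_le_tsum`, `squeeze_zero_norm'`, `Filter.Tendsto.div_atTop`,
`Nat.tendsto_div_const_atTop`, `tendsto_nhds_unique`,
`IsMultiplicative.prodPrimeFactors_one_add_of_squarefree`,
`Nat.coprime_div_gcd_of_squarefree`, `Finset.sum_nbij'`. The tree: `sigmaHalf`, `one_le_sigmaHalf`
(`…Inputs`), `sum_divisors_moebius_real` (`∑_{d ∣ m} μ(d) = [m = 1]`, `…SieveFrameworkProofs`).
No Abel-summation-with-log or divisor-recursion lemma of this kind exists in Mathlib or the tree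
(`lean search 'sum_mul_log|moebius.*Coprime.*log'`); `Mathlib.NumberTheory.AbelSummation` is the
integral form, not needed here.
-/

noncomputable section

open Finset Filter Topology
open scoped ArithmeticFunction.Moebius ArithmeticFunction.zeta

namespace Literature.NumberTheory.Sieve

/-! ## Abel summation with logarithmic weights -/

/-- **Abel summation with the weight `log`**:
`∑_{b ≤ N} f(b) log b = S(N) log N - ∑_{b < N} S(b) (log(b+1) - log b)`, `S(b) = ∑_{c ≤ b} f(c)`.
[folklore] -/
theorem sum_Icc_mul_log_eq (f : ℕ → ℝ) (N : ℕ) :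
    ∑ b ∈ Icc 1 N, f b * Real.log b =
      (∑ b ∈ Icc 1 N, f b) * Real.log N -
        ∑ b ∈ Finset.range N, (∑ c ∈ Icc 1 b, f c) * (Real.log (b + 1) - Real.log b) := by
  induction N with
  | zero => simp
  | succ N ih =>
    rw [Finset.sum_Icc_succ_top (by omega), Finset.sum_Icc_succ_top (by omega), ih,
      Finset.sum_range_succ]
    push_cast
    ring

/-- The elementary inequality behind the tail estimate: for `0 < u ≤ v`,
`(v - u) / v^6 ≤ (u^{-5} - v^{-5}) / 5`. [folklore] -/
theorem sub_div_pow_six_le {u v : ℝ} (hu : 0 < u) (huv : u ≤ v) :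
    (v - u) / v ^ 6 ≤ ((u ^ 5)⁻¹ - (v ^ 5)⁻¹) / 5 := by
  obtain ⟨w, hw1, rfl⟩ : ∃ w : ℝ, 1 ≤ w ∧ v = u * w :=
    ⟨v / u, by rwa [le_div_iff₀ hu, one_mul], by field_simp⟩
  have hw0 : 0 < w := one_pos.trans_le hw1
  have hu0 : u ≠ 0 := hu.ne'
  have hw0' : w ≠ 0 := hw0.ne'
  have key : 5 * (w - 1) ≤ w * (w ^ 5 - 1) := by
    have h2 : 1 ≤ w ^ 2 := one_le_pow₀ hw1
    have h3 : 1 ≤ w ^ 3 := one_le_pow₀ hw1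
    have h4 : 1 ≤ w ^ 4 := one_le_pow₀ hw1
    have h5 : 1 ≤ w ^ 5 := one_le_pow₀ hw1
    have hsum : 5 ≤ w * (w ^ 4 + w ^ 3 + w ^ 2 + w + 1) := by nlinarith
    have hfac : w * (w ^ 5 - 1) - 5 * (w - 1) =
        (w - 1) * (w * (w ^ 4 + w ^ 3 + w ^ 2 + w + 1) - 5) := by ring
    nlinarith [mul_nonneg (sub_nonneg.2 hw1) (sub_nonneg.2 hsum)]
  rw [div_le_div_iff₀ (by positivity) (by norm_num : (0 : ℝ) < 5)]
  have h : ((u ^ 5)⁻¹ - ((u * w) ^ 5)⁻¹) * (u * w) ^ 6 = u * (w * (w ^ 5 - 1)) := by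
    field_simp
  rw [h]
  have : (u * w - u) * 5 = u * (5 * (w - 1)) := by ring
  rw [this]
  exact mul_le_mul_of_nonneg_left key hu.le

/-- **Convergence with rate from a `(log)^{-6}` bound on the partial sums**: if
`|∑_{b ≤ N} f(b)| ≤ K (log(N+1))^{-6}` for all `N ≥ 1`, then `∑_{b ≤ N} f(b) log b` converges, to
`r` say, and `|∑_{b ≤ N} f(b) log b - r| ≤ 2K (log N)^{-5}` for `N ≥ 2`. [folklore] -/
theorem tendsto_sum_mul_log_of_abs_sum_le {f : ℕ → ℝ} {K : ℝ} (hK : 0 ≤ K)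
    (hS : ∀ N : ℕ, 1 ≤ N → |∑ b ∈ Icc 1 N, f b| ≤ K / Real.log (N + 1) ^ 6) :
    ∃ r : ℝ, Tendsto (fun N : ℕ => ∑ b ∈ Icc 1 N, f b * Real.log b) atTop (𝓝 r) ∧
      ∀ N : ℕ, 2 ≤ N → |∑ b ∈ Icc 1 N, f b * Real.log b - r| ≤ 2 * K / Real.log N ^ 5 := by
  set S : ℕ → ℝ := fun N => ∑ b ∈ Icc 1 N, f b with hSdef
  set T : ℕ → ℝ := fun b => S b * (Real.log (b + 1) - Real.log b) with hTdef
  -- the telescoping majorant `a N i = (log (N + i))^{-5}`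
  set a : ℕ → ℕ → ℝ := fun N i => (Real.log ((N : ℝ) + i) ^ 5)⁻¹ with hadef
  have ha_anti : ∀ N i : ℕ, 2 ≤ N → a N (i + 1) ≤ a N i := by
    intro N i hN
    simp only [hadef]
    have h1 : (1 : ℝ) < N + i := by
      have : (2 : ℝ) ≤ N := by exact_mod_cast hN
      have : (0 : ℝ) ≤ i := Nat.cast_nonneg i
      linarith
    have hl : 0 < Real.log ((N : ℝ) + i) := Real.log_pos h1
    refine inv_anti₀ (pow_pos hl 5) (pow_le_pow_left₀ hl.le (Real.log_le_log (by linarith) ?_) 5)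
    push_cast
    linarith
  have ha_nonneg : ∀ N i : ℕ, 2 ≤ N → 0 ≤ a N i := by
    intro N i hN
    simp only [hadef]
    refine inv_nonneg.2 (pow_nonneg (Real.log_nonneg ?_) 5)
    have : (2 : ℝ) ≤ N := by exact_mod_cast hN
    have : (0 : ℝ) ≤ i := Nat.cast_nonneg i
    linarith
  -- `|T (N + i)| ≤ (K/5) (a N i - a N (i+1))` for `N ≥ 2`
  have hT : ∀ N i : ℕ, 2 ≤ N → |T (N + i)| ≤ K / 5 * (a N i - a N (i + 1)) := by
    intro N i hN
    have hb1 : 1 ≤ N + i := by omega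
    have hcast : ((N + i : ℕ) : ℝ) = (N : ℝ) + i := by push_cast; ring
    have hlogb : 0 < Real.log ((N : ℝ) + i) := by
      refine Real.log_pos ?_
      have : (2 : ℝ) ≤ N := by exact_mod_cast hN
      have : (0 : ℝ) ≤ i := Nat.cast_nonneg i
      linarith
    have hpos : (0 : ℝ) < N + i := by
      have : (2 : ℝ) ≤ N := by exact_mod_cast hN
      have : (0 : ℝ) ≤ i := Nat.cast_nonneg i
      linarith
    have hle : Real.log ((N : ℝ) + i) ≤ Real.log ((N : ℝ) + i + 1) :=
      Real.log_le_log hpos (by linarith)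
    have hT1 : |T (N + i)| ≤ K / Real.log ((N : ℝ) + i + 1) ^ 6 *
        (Real.log ((N : ℝ) + i + 1) - Real.log ((N : ℝ) + i)) := by
      simp only [hTdef, hcast]
      rw [abs_mul, abs_of_nonneg (sub_nonneg.2 hle)]
      refine mul_le_mul_of_nonneg_right ?_ (sub_nonneg.2 hle)
      have := hS (N + i) hb1
      rwa [hcast] at this
    refine hT1.trans ?_
    have key := sub_div_pow_six_le hlogb hle
    simp only [hadef]
    push_cast
    calc K / Real.log ((N : ℝ) + i + 1) ^ 6 * (Real.log ((N : ℝ) + i + 1) - Real.log ((N : ℝ) + i))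
        = K * ((Real.log ((N : ℝ) + i + 1) - Real.log ((N : ℝ) + i)) /
            Real.log ((N : ℝ) + i + 1) ^ 6) := by ring
      _ ≤ K * (((Real.log ((N : ℝ) + i) ^ 5)⁻¹ - (Real.log ((N : ℝ) + i + 1) ^ 5)⁻¹) / 5) :=
          mul_le_mul_of_nonneg_left key hK
      _ = K / 5 * ((Real.log ((N : ℝ) + i) ^ 5)⁻¹ -
          (Real.log ((N : ℝ) + ((i : ℝ) + 1)) ^ 5)⁻¹) := by
          simp only [add_assoc]; ring
  -- summability of the majorant and of `T`
  have hg_sum : ∀ N : ℕ, 2 ≤ N →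
      HasSum (fun i => K / 5 * (a N i - a N (i + 1))) (K / 5 * a N 0) := by
    intro N hN
    have hlim : Tendsto (fun M : ℕ => K / 5 * (a N 0 - a N M)) atTop (𝓝 (K / 5 * (a N 0 - 0))) := by
      refine Tendsto.const_mul _ (tendsto_const_nhds.sub ?_)
      simp only [hadef]
      refine tendsto_inv_atTop_zero.comp ?_
      refine (tendsto_pow_atTop (by norm_num : (5 : ℕ) ≠ 0)).comp ?_
      refine Real.tendsto_log_atTop.comp ?_
      exact tendsto_atTop_add_const_left _ _ tendsto_natCast_atTop_atTop
    rw [sub_zero] at hlim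
    have hpartial : ∀ M : ℕ, ∑ i ∈ Finset.range M, K / 5 * (a N i - a N (i + 1)) =
        K / 5 * (a N 0 - a N M) := by
      intro M
      rw [← Finset.mul_sum, Finset.sum_range_sub']
    refine (hasSum_iff_tendsto_nat_of_nonneg (fun i => ?_) _).2 ?_
    · exact mul_nonneg (by positivity) (sub_nonneg.2 (ha_anti N i hN))
    · simpa only [hpartial] using hlim
  have hTshift_sum : ∀ N : ℕ, 2 ≤ N → Summable fun i => |T (N + i)| := fun N hN =>
    (hg_sum N hN).summable.of_nonneg_of_le (fun i => abs_nonneg _) (fun i => hT N i hN)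
  have hT_sum : Summable T := by
    have h2 : Summable fun i => T (i + 2) := by
      have := (hTshift_sum 2 le_rfl).of_abs
      simpa only [add_comm] using this
    exact (summable_nat_add_iff 2).1 h2
  -- the limit
  set r : ℝ := -∑' b, T b with hr
  have hRN : ∀ N : ℕ, ∑ b ∈ Icc 1 N, f b * Real.log b - r = S N * Real.log N + ∑' i, T (i + N) := by
    intro N
    rw [sum_Icc_mul_log_eq f N, hr, sub_neg_eq_add, ← hT_sum.sum_add_tsum_nat_add N]
    simp only [hSdef, hTdef]
    ring
  have hbound : ∀ N : ℕ, 2 ≤ N →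
      |∑ b ∈ Icc 1 N, f b * Real.log b - r| ≤ 2 * K / Real.log N ^ 5 := by
    intro N hN
    have hN1 : 1 ≤ N := by omega
    have hN2 : (2 : ℝ) ≤ N := by exact_mod_cast hN
    have hlogN : 0 < Real.log N := Real.log_pos (by linarith)
    have hlogN1 : Real.log N ≤ Real.log (N + 1) := Real.log_le_log (by linarith) (by linarith)
    rw [hRN N]
    have htail : |∑' i, T (i + N)| ≤ K / 5 * a N 0 := by
      have hs : Summable fun i => |T (i + N)| := by
        simpa only [add_comm] using hTshift_sum N hN
      have hs' : Summable fun i => ‖T (i + N)‖ := by simpa only [Real.norm_eq_abs] using hs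
      rw [← Real.norm_eq_abs]
      refine (norm_tsum_le_tsum_norm hs').trans ?_
      simp only [Real.norm_eq_abs]
      rw [← (hg_sum N hN).tsum_eq]
      refine Summable.tsum_le_tsum (fun i => ?_) hs (hg_sum N hN).summable
      rw [add_comm]; exact hT N i hN
    have hmain : |S N * Real.log N| ≤ K / Real.log N ^ 5 := by
      rw [abs_mul, abs_of_pos hlogN]
      calc |S N| * Real.log N ≤ K / Real.log (N + 1) ^ 6 * Real.log N :=
            mul_le_mul_of_nonneg_right (hS N hN1) hlogN.le
        _ ≤ K / Real.log N ^ 6 * Real.log N := by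
            refine mul_le_mul_of_nonneg_right ?_ hlogN.le
            exact div_le_div_of_nonneg_left hK (pow_pos hlogN 6)
              (pow_le_pow_left₀ hlogN.le hlogN1 6)
        _ = K / Real.log N ^ 5 := by field_simp
    have ha0 : a N 0 = (Real.log N ^ 5)⁻¹ := by simp [hadef]
    calc |S N * Real.log N + ∑' i, T (i + N)|
        ≤ |S N * Real.log N| + |∑' i, T (i + N)| := abs_add_le _ _
      _ ≤ K / Real.log N ^ 5 + K / 5 * (Real.log N ^ 5)⁻¹ := add_le_add hmain (ha0 ▸ htail)
      _ ≤ 2 * K / Real.log N ^ 5 := by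
          rw [← div_eq_mul_inv, div_div, div_add_div _ _ (pow_ne_zero 5 hlogN.ne')
            (by positivity), div_le_div_iff₀ (by positivity) (by positivity)]
          nlinarith [pow_pos hlogN 5, pow_pos hlogN 10]
  -- the limit statement
  refine ⟨r, ?_, hbound⟩
  have h0 : Tendsto (fun N : ℕ => 2 * K / Real.log N ^ 5) atTop (𝓝 0) := by
    have : Tendsto (fun N : ℕ => Real.log N ^ 5) atTop atTop :=
      (tendsto_pow_atTop (by norm_num)).comp
        (Real.tendsto_log_atTop.comp tendsto_natCast_atTop_atTop)
    exact tendsto_const_nhds.div_atTop this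
  have h1 : Tendsto (fun N : ℕ => ∑ b ∈ Icc 1 N, f b * Real.log b - r) atTop (𝓝 0) := by
    refine squeeze_zero_norm' ?_ h0
    filter_upwards [eventually_ge_atTop 2] with N hN
    rw [Real.norm_eq_abs]
    exact hbound N hN
  exact tendsto_sub_nhds_zero_iff.mp h1


/-! ## The divisor recursion -/

/-- The multiples of `η ≥ 1` in `[1, N]` are the `η c`, `1 ≤ c ≤ N/η`. [folklore] -/
theorem filter_dvd_Icc_eq_image {η : ℕ} (hη : 0 < η) (N : ℕ) :
    (Icc 1 N).filter (fun b => η ∣ b) = (Icc 1 (N / η)).image (fun c => η * c) := by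
  ext b
  simp only [Finset.mem_filter, Finset.mem_image, Finset.mem_Icc]
  constructor
  · rintro ⟨⟨hb1, hbN⟩, ⟨c, rfl⟩⟩
    refine ⟨c, ⟨?_, ?_⟩, rfl⟩
    · rcases Nat.eq_zero_or_pos c with h | h
      · rw [h, mul_zero] at hb1; omega
      · exact h
    · rw [Nat.le_div_iff_mul_le hη, mul_comm]; exact hbN
  · rintro ⟨c, ⟨hc1, hcN⟩, rfl⟩
    rw [Nat.le_div_iff_mul_le hη] at hcN
    exact ⟨⟨Nat.mul_pos hη hc1, by rw [mul_comm]; exact hcN⟩, dvd_mul_right _ _⟩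

/-- The coprimality indicator via Möbius over the common divisors with a squarefree-or-not `ν`:
`[(b, ν) = 1] = ∑_{η ∣ ν, η ∣ b} μ(η)` for `b, ν ≥ 1`. [folklore] -/
theorem ite_coprime_eq_sum_moebius {b ν : ℕ} (hb : b ≠ 0) (hν : ν ≠ 0) :
    (if b.Coprime ν then (1 : ℝ) else 0) = ∑ η ∈ ν.divisors with η ∣ b, (μ η : ℝ) := by
  have hset : ν.divisors.filter (fun η => η ∣ b) = (Nat.gcd b ν).divisors := by
    ext η
    simp only [Finset.mem_filter, Nat.mem_divisors, Nat.dvd_gcd_iff]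
    constructor
    · rintro ⟨⟨h1, -⟩, h2⟩; exact ⟨⟨h2, h1⟩, Nat.gcd_ne_zero_left hb⟩
    · rintro ⟨⟨h2, h1⟩, -⟩; exact ⟨⟨h1, hν⟩, h2⟩
  rw [hset, sum_divisors_moebius_real]

/-- **The divisor recursion** (FI §4 p. 1053): for squarefree `ν` and multiplicative `g`,
`∑_{b ≤ N, (b,ν)=1} μ(b) g(b) log b
  = ∑_{η ∣ ν} g(η) (log η ∑_{c ≤ N/η, (c,η)=1} μ(c)g(c) + ∑_{c ≤ N/η, (c,η)=1} μ(c)g(c) log c)`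
(write `[(b,ν)=1] = ∑_{η ∣ (b,ν)} μ(η)`, `b = ηc`, `μ(ηc)g(ηc) = μ(η)μ(c)g(η)g(c)` for `(η,c)=1`
and `= 0` otherwise, `μ(η)² = 1`). [cite: FriedlanderIwaniecASP1998, §4 p. 1053] -/
theorem sum_coprime_moebius_mul_log_eq {g : ArithmeticFunction ℝ} (hg : g.IsMultiplicative)
    {ν : ℕ} (hν : Squarefree ν) (N : ℕ) :
    ∑ b ∈ (Icc 1 N).filter (fun b => b.Coprime ν), (μ b : ℝ) * g b * Real.log b =
      ∑ η ∈ ν.divisors, g η *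
        (Real.log η * ∑ c ∈ (Icc 1 (N / η)).filter (fun c => c.Coprime η), (μ c : ℝ) * g c +
          ∑ c ∈ (Icc 1 (N / η)).filter (fun c => c.Coprime η),
            (μ c : ℝ) * g c * Real.log c) := by
  classical
  have hν0 : ν ≠ 0 := hν.ne_zero
  set F : ℕ → ℝ := fun b => (μ b : ℝ) * g b * Real.log b with hF
  -- Step A: the coprimality indicator
  have hA : ∑ b ∈ (Icc 1 N).filter (fun b => b.Coprime ν), F b =
      ∑ b ∈ Icc 1 N, ∑ η ∈ ν.divisors, if η ∣ b then (μ η : ℝ) * F b else 0 := by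
    rw [Finset.sum_filter]
    refine Finset.sum_congr rfl fun b hb => ?_
    have hb0 : b ≠ 0 := by have := (Finset.mem_Icc.mp hb).1; omega
    rw [← boole_mul, ite_coprime_eq_sum_moebius hb0 hν0, Finset.sum_mul, Finset.sum_filter]
  -- Step B: swap and reindex over the multiples of `η`
  have hB : ∑ b ∈ Icc 1 N, ∑ η ∈ ν.divisors, (if η ∣ b then (μ η : ℝ) * F b else 0) =
      ∑ η ∈ ν.divisors, (μ η : ℝ) * ∑ c ∈ Icc 1 (N / η), F (η * c) := by
    rw [Finset.sum_comm]
    refine Finset.sum_congr rfl fun η hη => ?_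
    have hη0 : 0 < η := Nat.pos_of_mem_divisors hη
    rw [← Finset.sum_filter, filter_dvd_Icc_eq_image hη0, Finset.sum_image, Finset.mul_sum]
    intro c₁ _ c₂ _ h
    exact Nat.eq_of_mul_eq_mul_left hη0 h
  -- Step C: the inner sums
  have hC : ∀ η ∈ ν.divisors, ∑ c ∈ Icc 1 (N / η), F (η * c) =
      (μ η : ℝ) * g η *
        (Real.log η * ∑ c ∈ (Icc 1 (N / η)).filter (fun c => c.Coprime η), (μ c : ℝ) * g c +
          ∑ c ∈ (Icc 1 (N / η)).filter (fun c => c.Coprime η),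
            (μ c : ℝ) * g c * Real.log c) := by
    intro η hη
    have hη0 : 0 < η := Nat.pos_of_mem_divisors hη
    rw [mul_add, Finset.mul_sum, Finset.mul_sum, Finset.mul_sum, ← Finset.sum_add_distrib,
      Finset.sum_filter]
    refine Finset.sum_congr rfl fun c hc => ?_
    have hc0 : 0 < c := (Finset.mem_Icc.mp hc).1
    simp only [hF]
    split_ifs with hcop
    · rw [ArithmeticFunction.isMultiplicative_moebius.map_mul_of_coprime hcop.symm,
        hg.map_mul_of_coprime hcop.symm, Nat.cast_mul,
        Real.log_mul (by exact_mod_cast hη0.ne') (by exact_mod_cast hc0.ne')]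
      push_cast
      ring
    · have hns : ¬Squarefree (η * c) := fun h => hcop (Nat.squarefree_mul_iff.mp h).1.symm
      rw [ArithmeticFunction.moebius_eq_zero_of_not_squarefree hns]
      simp
  rw [hA, hB]
  refine Finset.sum_congr rfl fun η hη => ?_
  -- `μ(η)² = 1`
  have hηsq : Squarefree η := hν.squarefree_of_dvd (Nat.dvd_of_mem_divisors hη)
  have hμ2 : (μ η : ℝ) * (μ η : ℝ) = 1 := by
    rw [ArithmeticFunction.moebius_apply_of_squarefree hηsq]
    push_cast
    rw [← pow_add, ← two_mul, pow_mul]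
    norm_num
  rw [hC η hη, ← mul_assoc, ← mul_assoc, hμ2, one_mul]


/-! ## Limits and their values -/

variable {g : ArithmeticFunction ℝ}

/-- **Passing to the limit in the divisor recursion**: if `S_η(M) → 0` and `R_η(M) → r_η` for all
`η ∣ ν` and `R_ν(N) = ∑_{η ∣ ν} g(η)(log η S_η(N/η) + R_η(N/η))` for all `N`, then
`r_ν = ∑_{η ∣ ν} g(η) r_η`. [folklore] -/
theorem limit_of_divisor_recursion {ν : ℕ} (hν : ν ≠ 0) {S R : ℕ → ℕ → ℝ} {r : ℕ → ℝ}
    (hrec : ∀ N : ℕ, R ν N = ∑ η ∈ ν.divisors, g η * (Real.log η * S η (N / η) + R η (N / η)))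
    (hS : ∀ η ∈ ν.divisors, Tendsto (S η) atTop (𝓝 0))
    (hR : ∀ η ∈ ν.divisors, Tendsto (R η) atTop (𝓝 (r η))) :
    r ν = ∑ η ∈ ν.divisors, g η * r η := by
  have h1 : Tendsto (R ν) atTop (𝓝 (r ν)) := hR ν (Nat.mem_divisors_self ν hν)
  have h2 : Tendsto (R ν) atTop (𝓝 (∑ η ∈ ν.divisors, g η * (Real.log η * 0 + r η))) := by
    have : R ν = fun N => ∑ η ∈ ν.divisors, g η * (Real.log η * S η (N / η) + R η (N / η)) :=
      funext hrec
    rw [this]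
    refine tendsto_finsetSum _ fun η hη => ?_
    have hη0 : η ≠ 0 := (Nat.pos_of_mem_divisors hη).ne'
    refine Tendsto.const_mul _ (Tendsto.add (Tendsto.const_mul _ ?_) ?_)
    · exact (hS η hη).comp (Nat.tendsto_div_const_atTop hη0)
    · exact (hR η hη).comp (Nat.tendsto_div_const_atTop hη0)
  have := tendsto_nhds_unique h1 h2
  simpa using this

/-- `V(η) = ∏_{p ∣ η} (1 - g(p))` is positive when `g(p) < 1`. [folklore] -/
theorem prod_one_sub_pos (h01 : ∀ p : ℕ, p.Prime → 0 ≤ g p ∧ g p < 1) (η : ℕ) :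
    0 < ∏ p ∈ η.primeFactors, (1 - g p) :=
  Finset.prod_pos fun p hp => sub_pos.2 (h01 p (Nat.prime_of_mem_primeFactors hp)).2

/-- `∑_{η ∣ ν} g(η) / V(η) = 1 / V(ν)` for squarefree `ν` and multiplicative `g` with `g(p) < 1`
(`η ↦ g(η)/V(η)` is multiplicative and `1 + g(p)/(1 - g(p)) = (1 - g(p))⁻¹`). [folklore] -/
theorem sum_divisors_density_div_prod_eq (hg : g.IsMultiplicative)
    (h01 : ∀ p : ℕ, p.Prime → 0 ≤ g p ∧ g p < 1) {ν : ℕ} (hν : Squarefree ν) :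
    ∑ η ∈ ν.divisors, g η / ∏ p ∈ η.primeFactors, (1 - g p) =
      (∏ p ∈ ν.primeFactors, (1 - g p))⁻¹ := by
  set f := ArithmeticFunction.prodPrimeFactors (fun p : ℕ => g p / (1 - g p)) with hf
  have hfm : f.IsMultiplicative := ArithmeticFunction.IsMultiplicative.prodPrimeFactors _
  have hfη : ∀ η ∈ ν.divisors, f η = g η / ∏ p ∈ η.primeFactors, (1 - g p) := by
    intro η hη
    have hηsq : Squarefree η := hν.squarefree_of_dvd (Nat.dvd_of_mem_divisors hη)
    rw [hf, ArithmeticFunction.prodPrimeFactors_apply hηsq.ne_zero, Finset.prod_div_distrib]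
    congr 1
    conv_rhs => rw [← Nat.prod_primeFactors_of_squarefree hηsq]
    exact (hg.map_prod_of_subset_primeFactors η η.primeFactors Finset.Subset.rfl).symm
  rw [← Finset.sum_congr rfl hfη, ← hfm.prodPrimeFactors_one_add_of_squarefree hν,
    ← Finset.prod_inv_distrib]
  refine Finset.prod_congr rfl fun p hp => ?_
  have hpp := Nat.prime_of_mem_primeFactors hp
  have h1 : 1 - g p ≠ 0 := (sub_pos.2 (h01 p hpp).2).ne'
  rw [hf, ArithmeticFunction.prodPrimeFactors_apply hpp.ne_zero, hpp.primeFactors,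
    Finset.prod_singleton]
  field_simp
  ring

/-- **The values of the limits**: if `r_ν = ∑_{η ∣ ν} g(η) r_η` for all squarefree `ν` and
`r_1 = -H`, then `r_ν = -H / V(ν)` for all squarefree `ν` (induction on `ν`, using
`∑_{η ∣ ν} g(η)/V(η) = 1/V(ν)` and `g(ν) < 1`). [cite: FriedlanderIwaniecASP1998, §4 p. 1054] -/
theorem limit_values (hg : g.IsMultiplicative) (h01 : ∀ p : ℕ, p.Prime → 0 ≤ g p ∧ g p < 1)
    {H : ℝ} {r : ℕ → ℝ} (hrec : ∀ ν : ℕ, Squarefree ν → r ν = ∑ η ∈ ν.divisors, g η * r η)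
    (h1 : r 1 = -H) :
    ∀ ν : ℕ, Squarefree ν → r ν = -H / ∏ p ∈ ν.primeFactors, (1 - g p) := by
  intro ν
  induction ν using Nat.strong_induction_on with
  | _ ν ih =>
    intro hν
    rcases eq_or_ne ν 1 with rfl | hν1
    · simp [h1]
    have hν0 : ν ≠ 0 := hν.ne_zero
    set V : ℕ → ℝ := fun η => ∏ p ∈ η.primeFactors, (1 - g p) with hV
    have hVpos : ∀ η, 0 < V η := prod_one_sub_pos h01
    -- split off `η = ν`
    have hdiv : ∀ f : ℕ → ℝ, ∑ η ∈ ν.divisors, f η = ∑ η ∈ ν.properDivisors, f η + f ν := by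
      intro f
      rw [← Nat.insert_self_properDivisors hν0, Finset.sum_insert Nat.self_notMem_properDivisors,
        add_comm]
    have hsplit := hrec ν hν
    rw [hdiv] at hsplit
    -- the proper divisors are smaller squarefree numbers
    have hprop : ∑ η ∈ ν.properDivisors, g η * r η = -H * ∑ η ∈ ν.properDivisors, g η / V η := by
      rw [Finset.mul_sum]
      refine Finset.sum_congr rfl fun η hη => ?_
      obtain ⟨hηd, hηlt⟩ := Nat.mem_properDivisors.mp hη
      rw [ih η hηlt (hν.squarefree_of_dvd hηd)]
      ring
    have hident : ∑ η ∈ ν.properDivisors, g η / V η = (V ν)⁻¹ - g ν / V ν := by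
      have := sum_divisors_density_div_prod_eq hg h01 hν
      rw [hdiv] at this
      simp only [hV]
      linarith
    -- `g ν < 1`
    have hgν : g ν < 1 := by
      obtain ⟨p, hp⟩ : ν.primeFactors.Nonempty := by
        rw [Finset.nonempty_iff_ne_empty, ne_eq, Nat.primeFactors_eq_empty]
        omega
      have hgν_eq : g ν = ∏ q ∈ ν.primeFactors, g q := by
        conv_lhs => rw [← Nat.prod_primeFactors_of_squarefree hν]
        exact hg.map_prod_of_subset_primeFactors ν ν.primeFactors Finset.Subset.rfl
      rw [hgν_eq, ← Finset.mul_prod_erase _ _ hp]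
      have hle : ∏ q ∈ ν.primeFactors.erase p, g q ≤ 1 :=
        Finset.prod_le_one (fun q hq => (h01 q (Nat.prime_of_mem_primeFactors
          (Finset.mem_of_mem_erase hq))).1)
          (fun q hq => (h01 q (Nat.prime_of_mem_primeFactors (Finset.mem_of_mem_erase hq))).2.le)
      have hge : 0 ≤ ∏ q ∈ ν.primeFactors.erase p, g q :=
        Finset.prod_nonneg fun q hq => (h01 q (Nat.prime_of_mem_primeFactors
          (Finset.mem_of_mem_erase hq))).1
      have hgp := h01 p (Nat.prime_of_mem_primeFactors hp)
      calc g p * ∏ q ∈ ν.primeFactors.erase p, g q ≤ g p * 1 :=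
            mul_le_mul_of_nonneg_left hle hgp.1
        _ < 1 := by rw [mul_one]; exact hgp.2
    -- solve the linear equation `r ν = -H ((V ν)⁻¹ - g ν / V ν) + g ν r ν`
    rw [hprop, hident] at hsplit
    have h1g : (1 - g ν) ≠ 0 := (sub_pos.2 hgν).ne'
    have h4 : (r ν + H * (V ν)⁻¹) * (1 - g ν) = 0 := by linear_combination hsplit
    rcases mul_eq_zero.1 h4 with h5 | h5
    · have h6 : (V ν)⁻¹ = (∏ p ∈ ν.primeFactors, (1 - g p))⁻¹ := rfl
      rw [div_eq_mul_inv, ← h6]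
      linarith
    · exact absurd h5 h1g


/-! ## The `gcd`-twisted rearrangement -/

/-- **The rearrangement `b = η b'` with `η = (b, ν)`** (FI §4 p. 1053): for squarefree `ν`,
multiplicative `g` and any weight `F`,
`∑_{b ≤ M, b sqfree} μ(b) g(b/(b,ν)) F(b) = ∑_{η ∣ ν} μ(η) ∑_{b' ≤ M/η, b' sqfree, (b',ν)=1}
μ(b') g(b') F(η b')`. [cite: FriedlanderIwaniecASP1998, §4 p. 1053] -/
theorem sum_squarefree_moebius_density_div_gcd_eq (g : ArithmeticFunction ℝ) (F : ℕ → ℝ)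
    {ν : ℕ} (hν : Squarefree ν) (M : ℕ) :
    ∑ b ∈ (Icc 1 M).filter Squarefree, (μ b : ℝ) * g (b / Nat.gcd b ν) * F b =
      ∑ η ∈ ν.divisors, (μ η : ℝ) *
        ∑ b' ∈ (Icc 1 (M / η)).filter (fun b' : ℕ => Squarefree b' ∧ b'.Coprime ν),
          (μ b' : ℝ) * g b' * F (η * b') := by
  classical
  have hν0 : ν ≠ 0 := hν.ne_zero
  set U := (Icc 1 M).filter Squarefree with hU
  set t : ℕ → Finset ℕ := fun η =>
    (Icc 1 (M / η)).filter (fun b' : ℕ => Squarefree b' ∧ b'.Coprime ν) with ht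
  have hbij : ∑ b ∈ U, (μ b : ℝ) * g (b / Nat.gcd b ν) * F b =
      ∑ p ∈ ν.divisors.sigma t, (μ p.1 : ℝ) * ((μ p.2 : ℝ) * g p.2 * F (p.1 * p.2)) := by
    refine Finset.sum_nbij' (fun b => (⟨Nat.gcd b ν, b / Nat.gcd b ν⟩ : Σ _ : ℕ, ℕ))
      (fun p => p.1 * p.2) ?_ ?_ ?_ ?_ ?_
    · -- into `ν.divisors.sigma t`
      intro b hb
      obtain ⟨hb1, hbsq⟩ := Finset.mem_filter.mp hb
      obtain ⟨hb1', hbM⟩ := Finset.mem_Icc.mp hb1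
      have hη : Nat.gcd b ν ∣ ν := Nat.gcd_dvd_right b ν
      have hηb : Nat.gcd b ν ∣ b := Nat.gcd_dvd_left b ν
      have hη0 : 0 < Nat.gcd b ν := Nat.gcd_pos_of_pos_left ν hb1'
      refine Finset.mem_sigma.mpr ⟨Nat.mem_divisors.mpr ⟨hη, hν0⟩,
        Finset.mem_filter.mpr ⟨?_, ?_, ?_⟩⟩
      · refine Finset.mem_Icc.mpr ⟨Nat.div_pos (Nat.le_of_dvd hb1' hηb) hη0, ?_⟩
        exact Nat.div_le_div_right hbM
      · exact hbsq.squarefree_of_dvd (Nat.div_dvd_of_dvd hηb)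
      · exact Nat.coprime_div_gcd_of_squarefree hbsq hν0
    · -- back into `U`
      rintro ⟨η, b'⟩ hp
      obtain ⟨hη, hb'⟩ := Finset.mem_sigma.mp hp
      obtain ⟨hη2, -⟩ := Nat.mem_divisors.mp hη
      obtain ⟨hb'1, hb'sq, hb'ν⟩ := Finset.mem_filter.mp hb'
      obtain ⟨hb'1', hb'M⟩ := Finset.mem_Icc.mp hb'1
      have hη0 : 0 < η := Nat.pos_of_dvd_of_pos hη2 (Nat.pos_of_ne_zero hν0)
      have hcop : η.Coprime b' := (Nat.Coprime.coprime_dvd_right hη2 hb'ν).symm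
      refine Finset.mem_filter.mpr ⟨Finset.mem_Icc.mpr ⟨Nat.mul_pos hη0 hb'1', ?_⟩, ?_⟩
      · rw [Nat.le_div_iff_mul_le hη0] at hb'M
        rw [mul_comm]; exact hb'M
      · exact Nat.squarefree_mul_iff.mpr ⟨hcop, hν.squarefree_of_dvd hη2, hb'sq⟩
    · -- left inverse
      intro b _
      exact Nat.mul_div_cancel' (Nat.gcd_dvd_left b ν)
    · -- right inverse
      rintro ⟨η, b'⟩ hp
      dsimp only at hp ⊢
      obtain ⟨hη, hb'⟩ := Finset.mem_sigma.mp hp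
      obtain ⟨hη2, -⟩ := Nat.mem_divisors.mp hη
      obtain ⟨-, -, hb'ν⟩ := Finset.mem_filter.mp hb'
      have hη0 : 0 < η := Nat.pos_of_dvd_of_pos hη2 (Nat.pos_of_ne_zero hν0)
      have hgcd : Nat.gcd (η * b') ν = η := by
        obtain ⟨q, hq⟩ := hη2
        have hb'q : b'.Coprime q := Nat.Coprime.coprime_dvd_right ⟨η, by rw [hq, mul_comm]⟩ hb'ν
        conv_lhs => rw [hq]
        rw [Nat.gcd_mul_left, hb'q.gcd_eq_one, mul_one]
      simp only [hgcd, Nat.mul_div_cancel_left b' hη0]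
    · -- the summands agree
      intro b hb
      obtain ⟨-, hbsq⟩ := Finset.mem_filter.mp hb
      have hηb : Nat.gcd b ν ∣ b := Nat.gcd_dvd_left b ν
      have hsplit : b = Nat.gcd b ν * (b / Nat.gcd b ν) := (Nat.mul_div_cancel' hηb).symm
      have hcop : (Nat.gcd b ν).Coprime (b / Nat.gcd b ν) := by
        refine Nat.coprime_of_squarefree_mul ?_
        rwa [← hsplit]
      have hμ : (μ b : ℝ) = (μ (Nat.gcd b ν) : ℝ) * (μ (b / Nat.gcd b ν) : ℝ) := by
        conv_lhs => rw [hsplit]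
        rw [ArithmeticFunction.isMultiplicative_moebius.map_mul_of_coprime hcop, Int.cast_mul]
      simp only
      rw [hμ, ← hsplit]
      ring
  rw [hU] at hbij
  rw [hbij, Finset.sum_sigma]
  refine Finset.sum_congr rfl fun η _ => ?_
  rw [Finset.mul_sum]

/-- Dropping the squarefree condition: `μ` vanishes off the squarefree numbers. [folklore] -/
theorem sum_filter_squarefree_and_eq (P : ℕ → Prop) [DecidablePred P] (G : ℕ → ℝ) (s : Finset ℕ) :
    ∑ b ∈ s.filter (fun b => Squarefree b ∧ P b), (μ b : ℝ) * G b =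
      ∑ b ∈ s.filter P, (μ b : ℝ) * G b := by
  classical
  have : s.filter (fun b => Squarefree b ∧ P b) = (s.filter P).filter Squarefree := by
    ext b; simp only [Finset.mem_filter]; tauto
  rw [this, Finset.sum_filter_of_ne]
  intro b _ hne
  by_contra hsq
  exact hne (by rw [ArithmeticFunction.moebius_eq_zero_of_not_squarefree hsq, Int.cast_zero,
    zero_mul])

/-- **FI's rearrangement for the log-weighted sum** (FI §4 p. 1053): for squarefree `ν`,
`∑_{b ≤ M, b sqfree} μ(b) g(b/(b,ν)) log b
  = ∑_{η ∣ ν} μ(η) (log η · S_ν(M/η) + R_ν(M/η))`,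
with `S_ν(L) = ∑_{c ≤ L, (c,ν)=1} μ(c) g(c)`, `R_ν(L) = ∑_{c ≤ L, (c,ν)=1} μ(c) g(c) log c`.
[cite: FriedlanderIwaniecASP1998, §4 p. 1053] -/
theorem sum_squarefree_moebius_density_div_gcd_mul_log_eq (g : ArithmeticFunction ℝ) {ν : ℕ}
    (hν : Squarefree ν) (M : ℕ) :
    ∑ b ∈ (Icc 1 M).filter Squarefree, (μ b : ℝ) * g (b / Nat.gcd b ν) * Real.log b =
      ∑ η ∈ ν.divisors, (μ η : ℝ) *
        (Real.log η * ∑ c ∈ (Icc 1 (M / η)).filter (fun c : ℕ => c.Coprime ν), (μ c : ℝ) * g c +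
          ∑ c ∈ (Icc 1 (M / η)).filter (fun c : ℕ => c.Coprime ν),
            (μ c : ℝ) * g c * Real.log c) := by
  classical
  rw [sum_squarefree_moebius_density_div_gcd_eq g (fun b => Real.log b) hν M]
  refine Finset.sum_congr rfl fun η hη => ?_
  have hη0 : 0 < η := Nat.pos_of_mem_divisors hη
  congr 1
  calc ∑ b' ∈ (Icc 1 (M / η)).filter (fun b' : ℕ => Squarefree b' ∧ b'.Coprime ν),
        (μ b' : ℝ) * g b' * Real.log ((η * b' : ℕ) : ℝ)
      = ∑ b' ∈ (Icc 1 (M / η)).filter (fun b' : ℕ => Squarefree b' ∧ b'.Coprime ν),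
          (μ b' : ℝ) * (g b' * Real.log ((η * b' : ℕ) : ℝ)) :=
        Finset.sum_congr rfl fun _ _ => mul_assoc _ _ _
    _ = ∑ b' ∈ (Icc 1 (M / η)).filter (fun b' : ℕ => b'.Coprime ν),
          (μ b' : ℝ) * (g b' * Real.log ((η * b' : ℕ) : ℝ)) := sum_filter_squarefree_and_eq _ _ _
    _ = ∑ b' ∈ (Icc 1 (M / η)).filter (fun b' : ℕ => b'.Coprime ν),
          (Real.log η * ((μ b' : ℝ) * g b') + (μ b' : ℝ) * g b' * Real.log b') := by
        refine Finset.sum_congr rfl fun b' hb' => ?_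
        have hb'0 : 0 < b' := (Finset.mem_Icc.mp (Finset.mem_filter.mp hb').1).1
        rw [Nat.cast_mul, Real.log_mul (by exact_mod_cast hη0.ne') (by exact_mod_cast hb'0.ne')]
        ring
    _ = _ := by rw [Finset.sum_add_distrib, ← Finset.mul_sum]


/-! ## From (2.4) and (1.14): the limits and the complete inner sums -/

section Values

variable {K H : ℝ}

/-- **(2.4) at integer points with the shifted logarithm**: under the conclusion of
`fi_moebius_density_cancellation` (constant `K ≥ 0`), for `ν, N ≥ 1`,
`|∑_{d ≤ N, (d,ν)=1} μ(d)g(d)| ≤ (64Kσ_ν + 1)(log(N+1))^{-6}` (`log(N+1) ≤ 2 log N` for `N ≥ 2`;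
the term `N = 1` is `μ(1)g(1) = 1`). [cite: FriedlanderIwaniecASP1998, §2 (2.4)] -/
theorem abs_sum_coprime_moebius_le (hg : g.IsMultiplicative) (hK : 0 ≤ K)
    (h24 : ∀ ν : ℕ, 1 ≤ ν → ∀ y : ℝ, 2 ≤ y →
      |∑ d ∈ (Icc 1 ⌊y⌋₊).filter (fun d : ℕ => d.Coprime ν), (μ d : ℝ) * g d| ≤
        K * sigmaHalf ν / Real.log y ^ 6)
    {ν : ℕ} (hν : 1 ≤ ν) {N : ℕ} (hN : 1 ≤ N) :
    |∑ d ∈ (Icc 1 N).filter (fun d : ℕ => d.Coprime ν), (μ d : ℝ) * g d| ≤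
      (64 * K * sigmaHalf ν + 1) / Real.log (N + 1) ^ 6 := by
  have hσ : 1 ≤ sigmaHalf ν := one_le_sigmaHalf ν
  have hKσ : 0 ≤ 64 * K * sigmaHalf ν := by positivity
  have hl2 : 0 < Real.log 2 := Real.log_pos one_lt_two
  have hl2' : Real.log 2 < 1 := by have := Real.log_two_lt_d9; linarith
  rcases eq_or_lt_of_le hN with h1 | hN2
  · -- `N = 1`
    subst h1
    have hset : (Icc 1 1).filter (fun d : ℕ => d.Coprime ν) = {1} := by
      rw [Finset.Icc_self, Finset.filter_singleton, if_pos (Nat.coprime_one_left ν)]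
    rw [hset, Finset.sum_singleton, ArithmeticFunction.moebius_apply_one, hg.map_one, Int.cast_one,
      one_mul, abs_one, Nat.cast_one, one_add_one_eq_two, le_div_iff₀ (pow_pos hl2 6), one_mul]
    calc Real.log 2 ^ 6 ≤ 1 ^ 6 := pow_le_pow_left₀ hl2.le hl2'.le 6
      _ = 1 := one_pow 6
      _ ≤ 64 * K * sigmaHalf ν + 1 := le_add_of_nonneg_left hKσ
  · -- `N ≥ 2`
    have hN2' : (2 : ℝ) ≤ N := by exact_mod_cast hN2
    have h := h24 ν hν N hN2'
    rw [Nat.floor_natCast] at h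
    refine h.trans ?_
    have hlogN : 0 < Real.log N := Real.log_pos (by linarith)
    have hlogN1 : 0 < Real.log (N + 1) := Real.log_pos (by linarith)
    have hlog2N : Real.log (N + 1) ≤ 2 * Real.log N := by
      rw [← Real.log_rpow (by linarith), Real.rpow_two]
      exact Real.log_le_log (by linarith) (by nlinarith)
    have hpow : Real.log (N + 1) ^ 6 ≤ 64 * Real.log N ^ 6 := by
      calc Real.log (N + 1) ^ 6 ≤ (2 * Real.log N) ^ 6 := pow_le_pow_left₀ hlogN1.le hlog2N 6
        _ = 64 * Real.log N ^ 6 := by ring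
    calc K * sigmaHalf ν / Real.log N ^ 6 = 64 * K * sigmaHalf ν / (64 * Real.log N ^ 6) := by
          field_simp
        _ ≤ 64 * K * sigmaHalf ν / Real.log (N + 1) ^ 6 :=
          div_le_div_of_nonneg_left hKσ (pow_pos hlogN1 6) hpow
        _ ≤ (64 * K * sigmaHalf ν + 1) / Real.log (N + 1) ^ 6 :=
          div_le_div_of_nonneg_right (by linarith) (pow_pos hlogN1 6).le

/-- **The limits `r_ν` of the coprime-restricted log-sums and their values** (FI §4 p. 1054:
"`∑_{η ∣ ν} μ(η) ∑_{(b,ν)=1} μ(b)g(b) log ηb … is equal to `-H` if `ν = 1` and equal to zero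
otherwise"). Under the conclusions of `fi_moebius_density_cancellation` (constant `K ≥ 0`) and
`fi_moebius_density_log_sum` (`∑_b μ(b)g(b) log b → -H`), for every squarefree `ν` the sums
`R_ν(N) = ∑_{c ≤ N, (c,ν)=1} μ(c)g(c) log c` converge to `-H/V(ν)`, `V(ν) = ∏_{p ∣ ν}(1 - g(p))`,
with `|R_ν(N) + H/V(ν)| ≤ 2(64Kσ_ν + 1)(log N)^{-5}` for `N ≥ 2`.
[cite: FriedlanderIwaniecASP1998, §4 p. 1054] -/
theorem tendsto_sum_coprime_moebius_mul_log (hg : g.IsMultiplicative)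
    (h01 : ∀ p : ℕ, p.Prime → 0 ≤ g p ∧ g p < 1) (hK : 0 ≤ K)
    (h24 : ∀ ν : ℕ, 1 ≤ ν → ∀ y : ℝ, 2 ≤ y →
      |∑ d ∈ (Icc 1 ⌊y⌋₊).filter (fun d : ℕ => d.Coprime ν), (μ d : ℝ) * g d| ≤
        K * sigmaHalf ν / Real.log y ^ 6)
    (h114 : Tendsto (fun N : ℕ => ∑ b ∈ Icc 1 N, (μ b : ℝ) * g b * Real.log b) atTop (𝓝 (-H)))
    {ν : ℕ} (hν : Squarefree ν) :
    Tendsto (fun N : ℕ => ∑ c ∈ (Icc 1 N).filter (fun c : ℕ => c.Coprime ν),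
        (μ c : ℝ) * g c * Real.log c) atTop (𝓝 (-H / ∏ p ∈ ν.primeFactors, (1 - g p))) ∧
      ∀ N : ℕ, 2 ≤ N →
        |∑ c ∈ (Icc 1 N).filter (fun c : ℕ => c.Coprime ν), (μ c : ℝ) * g c * Real.log c -
            (-H / ∏ p ∈ ν.primeFactors, (1 - g p))| ≤
          2 * (64 * K * sigmaHalf ν + 1) / Real.log N ^ 5 := by
  classical
  -- the limits for every `η ≥ 1`
  have hex : ∀ η : ℕ, ∃ r : ℝ, 1 ≤ η →
      Tendsto (fun N : ℕ => ∑ c ∈ (Icc 1 N).filter (fun c : ℕ => c.Coprime η),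
          (μ c : ℝ) * g c * Real.log c) atTop (𝓝 r) ∧
        ∀ N : ℕ, 2 ≤ N →
          |∑ c ∈ (Icc 1 N).filter (fun c : ℕ => c.Coprime η), (μ c : ℝ) * g c * Real.log c - r| ≤
            2 * (64 * K * sigmaHalf η + 1) / Real.log N ^ 5 := by
    intro η
    by_cases hη : 1 ≤ η
    · have hKη : 0 ≤ 64 * K * sigmaHalf η + 1 := by
        have := one_le_sigmaHalf η; positivity
      obtain ⟨r, hr1, hr2⟩ := tendsto_sum_mul_log_of_abs_sum_le
        (f := fun c => if c.Coprime η then (μ c : ℝ) * g c else 0) hKη (fun N hN => by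
          rw [← Finset.sum_filter]
          exact abs_sum_coprime_moebius_le hg hK h24 hη hN)
      have hrw : ∀ N : ℕ, ∑ b ∈ Icc 1 N, (if b.Coprime η then (μ b : ℝ) * g b else 0) * Real.log b =
          ∑ c ∈ (Icc 1 N).filter (fun c : ℕ => c.Coprime η), (μ c : ℝ) * g c * Real.log c := by
        intro N
        rw [Finset.sum_filter]
        refine Finset.sum_congr rfl fun b _ => ?_
        split_ifs <;> simp
      refine ⟨r, fun _ => ⟨?_, fun N hN => ?_⟩⟩
      · simpa only [hrw] using hr1
      · simpa only [hrw] using hr2 N hN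
    · exact ⟨0, fun h => absurd h hη⟩
  choose r hr using hex
  -- `S_η(N) → 0`
  have hS0 : ∀ η : ℕ, 1 ≤ η → Tendsto (fun N : ℕ =>
      ∑ c ∈ (Icc 1 N).filter (fun c : ℕ => c.Coprime η), (μ c : ℝ) * g c) atTop (𝓝 0) := by
    intro η hη
    have hlim : Tendsto (fun N : ℕ => (64 * K * sigmaHalf η + 1) / Real.log (N + 1) ^ 6)
        atTop (𝓝 0) := by
      refine tendsto_const_nhds.div_atTop ?_
      refine (tendsto_pow_atTop (by norm_num)).comp (Real.tendsto_log_atTop.comp ?_)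
      exact tendsto_atTop_add_const_right _ _ tendsto_natCast_atTop_atTop
    refine squeeze_zero_norm' ?_ hlim
    filter_upwards [eventually_ge_atTop 1] with N hN
    rw [Real.norm_eq_abs]
    exact abs_sum_coprime_moebius_le hg hK h24 hη hN
  -- the recursion in the limit, for squarefree arguments
  have hrec : ∀ m : ℕ, Squarefree m → r m = ∑ η ∈ m.divisors, g η * r η := by
    intro m hm
    refine limit_of_divisor_recursion (g := g) hm.ne_zero
      (S := fun η N => ∑ c ∈ (Icc 1 N).filter (fun c : ℕ => c.Coprime η), (μ c : ℝ) * g c)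
      (R := fun η N => ∑ c ∈ (Icc 1 N).filter (fun c : ℕ => c.Coprime η),
        (μ c : ℝ) * g c * Real.log c)
      (fun N => sum_coprime_moebius_mul_log_eq hg hm N)
      (fun η hη => hS0 η (Nat.pos_of_mem_divisors hη))
      (fun η hη => (hr η (Nat.pos_of_mem_divisors hη)).1)
  -- `r_1 = -H`
  have hr1 : r 1 = -H := by
    refine tendsto_nhds_unique (hr 1 le_rfl).1 ?_
    have hrw : ∀ N : ℕ, ∑ c ∈ (Icc 1 N).filter (fun c : ℕ => c.Coprime 1),
        (μ c : ℝ) * g c * Real.log c = ∑ b ∈ Icc 1 N, (μ b : ℝ) * g b * Real.log b := by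
      intro N
      rw [Finset.filter_true_of_mem fun c _ => Nat.coprime_one_right c]
    simpa only [hrw] using h114
  -- the values
  have hval := limit_values hg h01 hrec hr1 ν hν
  have hν1 : 1 ≤ ν := Nat.pos_of_ne_zero hν.ne_zero
  rw [← hval]
  exact hr ν hν1

/-- `∑_{η ∣ ν} μ(η) = [ν = 1]` in `ℝ`, pulled out of a constant. [folklore] -/
theorem sum_divisors_moebius_mul_const (ν : ℕ) (a : ℝ) :
    ∑ η ∈ ν.divisors, (μ η : ℝ) * a = if ν = 1 then a else 0 := by
  rw [← Finset.sum_mul, sum_divisors_moebius_real]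
  split_ifs <;> simp

/-- **The complete inner sum of FI §4** ("`∑_{b ≤ y} μ(b) g(b/(ν,b)) log b` … extend the summation
to all `b` making an error `≪ (log x)^{-3}` by (2.4) … equal to `-H` if `ν = 1` and equal to zero
otherwise"): under the conclusions of (2.4) and (1.14), for squarefree `ν` and `M ≥ 2ν`,
`|∑_{b ≤ M, b sqfree} μ(b) g(b/(b,ν)) log b - (-H)[ν = 1]|
  ≤ τ(ν) (64Kσ_ν + 1) (log ν (log(M/ν + 1))^{-6} + 2 (log(M/ν))^{-5})`.
[cite: FriedlanderIwaniecASP1998, §4 pp. 1053–1054] -/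
theorem abs_complete_inner_log_sum_sub_le (hg : g.IsMultiplicative)
    (h01 : ∀ p : ℕ, p.Prime → 0 ≤ g p ∧ g p < 1) (hK : 0 ≤ K)
    (h24 : ∀ ν : ℕ, 1 ≤ ν → ∀ y : ℝ, 2 ≤ y →
      |∑ d ∈ (Icc 1 ⌊y⌋₊).filter (fun d : ℕ => d.Coprime ν), (μ d : ℝ) * g d| ≤
        K * sigmaHalf ν / Real.log y ^ 6)
    (h114 : Tendsto (fun N : ℕ => ∑ b ∈ Icc 1 N, (μ b : ℝ) * g b * Real.log b) atTop (𝓝 (-H)))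
    {ν : ℕ} (hν : Squarefree ν) {M : ℕ} (hM : 2 * ν ≤ M) :
    |∑ b ∈ (Icc 1 M).filter Squarefree, (μ b : ℝ) * g (b / Nat.gcd b ν) * Real.log b -
        (if ν = 1 then -H else 0)| ≤
      (ν.divisors.card : ℝ) * (64 * K * sigmaHalf ν + 1) *
        (Real.log ν / Real.log ((M / ν : ℕ) + 1) ^ 6 + 2 / Real.log (M / ν : ℕ) ^ 5) := by
  classical
  have hν0 : ν ≠ 0 := hν.ne_zero
  have hν1 : 1 ≤ ν := Nat.pos_of_ne_zero hν0
  set V : ℝ := ∏ p ∈ ν.primeFactors, (1 - g p) with hV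
  set Kν : ℝ := 64 * K * sigmaHalf ν + 1 with hKν
  have hKν0 : 0 ≤ Kν := by have := one_le_sigmaHalf ν; positivity
  obtain ⟨-, hrate⟩ := tendsto_sum_coprime_moebius_mul_log hg h01 hK h24 h114 hν
  -- the value `-H/V(ν) [ν = 1] = -H [ν = 1]`
  have hval1 : (if ν = 1 then -H else 0) = ∑ η ∈ ν.divisors, (μ η : ℝ) * (-H / V) := by
    rw [sum_divisors_moebius_mul_const]
    split_ifs with h
    · subst h; simp [hV]
    · rfl
  rw [sum_squarefree_moebius_density_div_gcd_mul_log_eq g hν M, hval1, ← Finset.sum_sub_distrib]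
  -- termwise bounds
  have hMν : 2 ≤ M / ν := (Nat.le_div_iff_mul_le hν1).2 hM
  have hterm : ∀ η ∈ ν.divisors,
      |(μ η : ℝ) * (Real.log η * ∑ c ∈ (Icc 1 (M / η)).filter (fun c : ℕ => c.Coprime ν),
          (μ c : ℝ) * g c +
        ∑ c ∈ (Icc 1 (M / η)).filter (fun c : ℕ => c.Coprime ν), (μ c : ℝ) * g c * Real.log c) -
        (μ η : ℝ) * (-H / V)| ≤
      Kν * (Real.log ν / Real.log ((M / ν : ℕ) + 1) ^ 6 + 2 / Real.log (M / ν : ℕ) ^ 5) := by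
    intro η hη
    have hη0 : 0 < η := Nat.pos_of_mem_divisors hη
    have hην : η ≤ ν := Nat.divisor_le hη
    have hMη : M / ν ≤ M / η := Nat.div_le_div_left hην hη0
    have hMη2 : 2 ≤ M / η := hMν.trans hMη
    have hMη1 : 1 ≤ M / η := by omega
    -- the two pieces
    have hS := abs_sum_coprime_moebius_le hg hK h24 hν1 hMη1
    have hR := hrate (M / η) hMη2
    have hμ : |(μ η : ℝ)| ≤ 1 := by exact_mod_cast ArithmeticFunction.abs_moebius_le_one
    have hlogη : 0 ≤ Real.log η := Real.log_nonneg (by exact_mod_cast hη0)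
    have hlogην : Real.log η ≤ Real.log ν :=
      Real.log_le_log (by exact_mod_cast hη0) (by exact_mod_cast hην)
    -- monotonicity in the argument `M/η ≥ M/ν`
    have hcast : ((M / ν : ℕ) : ℝ) ≤ ((M / η : ℕ) : ℝ) := by exact_mod_cast hMη
    have h2 : (2 : ℝ) ≤ ((M / ν : ℕ) : ℝ) := by exact_mod_cast hMν
    have hl1 : 0 < Real.log ((M / ν : ℕ) + 1) := Real.log_pos (by linarith)
    have hl2 : 0 < Real.log ((M / ν : ℕ) : ℝ) := Real.log_pos (by linarith)
    have hmono1 : Kν / Real.log ((M / η : ℕ) + 1) ^ 6 ≤ Kν / Real.log ((M / ν : ℕ) + 1) ^ 6 :=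
      div_le_div_of_nonneg_left hKν0 (pow_pos hl1 6)
        (pow_le_pow_left₀ hl1.le (Real.log_le_log (by linarith) (by linarith)) 6)
    have hmono2 : 2 * Kν / Real.log ((M / η : ℕ) : ℝ) ^ 5 ≤
        2 * Kν / Real.log ((M / ν : ℕ) : ℝ) ^ 5 :=
      div_le_div_of_nonneg_left (by positivity) (pow_pos hl2 5)
        (pow_le_pow_left₀ hl2.le (Real.log_le_log (by linarith) hcast) 5)
    rw [← mul_sub, abs_mul]
    calc |(μ η : ℝ)| * |Real.log η * ∑ c ∈ (Icc 1 (M / η)).filter (fun c : ℕ => c.Coprime ν),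
            (μ c : ℝ) * g c +
          ∑ c ∈ (Icc 1 (M / η)).filter (fun c : ℕ => c.Coprime ν), (μ c : ℝ) * g c * Real.log c -
          -H / V|
        ≤ 1 * (Real.log η * (Kν / Real.log ((M / η : ℕ) + 1) ^ 6) +
            2 * Kν / Real.log ((M / η : ℕ) : ℝ) ^ 5) := by
          refine mul_le_mul hμ ?_ (abs_nonneg _) zero_le_one
          rw [add_sub_assoc]
          refine (abs_add_le _ _).trans (add_le_add ?_ hR)
          rw [abs_mul, abs_of_nonneg hlogη]
          exact mul_le_mul_of_nonneg_left hS hlogη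
      _ ≤ Kν * (Real.log ν / Real.log ((M / ν : ℕ) + 1) ^ 6 + 2 / Real.log (M / ν : ℕ) ^ 5) := by
          have e : Kν * (Real.log ν / Real.log ((M / ν : ℕ) + 1) ^ 6 +
              2 / Real.log (M / ν : ℕ) ^ 5) =
              Real.log ν * (Kν / Real.log ((M / ν : ℕ) + 1) ^ 6) +
                2 * Kν / Real.log ((M / ν : ℕ) : ℝ) ^ 5 := by ring
          rw [one_mul, e]
          refine add_le_add ?_ hmono2
          exact mul_le_mul hlogην hmono1 (by positivity) (hlogη.trans hlogην)
  calc |∑ η ∈ ν.divisors, _| ≤ ∑ η ∈ ν.divisors, |_| := Finset.abs_sum_le_sum_abs _ _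
    _ ≤ ∑ η ∈ ν.divisors, Kν * (Real.log ν / Real.log ((M / ν : ℕ) + 1) ^ 6 +
          2 / Real.log (M / ν : ℕ) ^ 5) := Finset.sum_le_sum hterm
    _ = _ := by rw [Finset.sum_const, nsmul_eq_mul, mul_assoc]

end Values

end Literature.NumberTheory.Sieve
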